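import Summits.CriticalPhenomena.PercolationContinuityZ3.Theorems.Transplant.SkelPhiWinLevels
import Summits.CriticalPhenomena.PercolationContinuityZ3.Theorems.Transplant.SkelWinSeedKit
import Summits.CriticalPhenomena.PercolationContinuityZ3.Theorems.Transplant.KNLevelsStepIII
import Summits.CriticalPhenomena.PercolationContinuityZ3.Theorems.Transplant.KNLevelsPacking
import HarnessLib

/-!
# D″ node, φ-level generic layer (SHEAR-SCOPE §3.14 ruling (B″), V98 p1 column): the ABSTRACT SEED KIT of a window level of a bare planar
# map `φ : V → ℤ²` — φ-level re-cut of `SkelSeedKit` §1/§3/§4 (p232099) ∪ `SkelWinSeedKit` (p234085), typed ONCE over a `[DecidableEq V]`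
# section binder

builds on p205010 (kernel theorem, internal audit signed; external expert review pending) — nothing in this file uses p205010.
Lane `prim-bschramm`, seat `prim-bschramm-p1` (gen 9); helper file (`--supports stmt-CriticalPhenomena-4575 --as helper`).

From a seed REGION `S x ∋ y x` and a face `U x` attached to every candidate contact `x` of the window level `B⟨j⟩ = Skelφ.winLevel G φ w₀ R
lo hi j` (hypotheses `Skelφ.KitOK`), the Step-III data `Skelφ.kitSData` (`K = ∂^{out}_{winGraph} B⟨j⟩`, seeds `SkelI.kitSeed` = contact edge
∪ `E(S x)` ∪ rungs, `pick = apartSel` over graph balls of radius `2 rs`, `N = k (Δ+1)^{2rs}`, `sB = 1 + Δ cS + cS cU` — the degree bound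
`hΔ : ∀ v, G.degree v ≤ Δ` is an ARGUMENT) and Kozma–Nitzan's Step-III axioms `KNLevels.SHyp` for the window level data `Skelφ.winLData`
(**`shyp_kit`**, from `hlip : Skelφ.Lip G φ` and `hΔ`), with the two facts Steps IV–V consume (`seed_subset_graphBall`; seeds avoid the pairs
of any vertex set missing `{x} ∪ S x` = the Φ-free `SkelI.seed_notMem_wireSet`, imported).  Every statement takes exactly the property of
`φ` it uses as a hypothesis, so ONE file serves `PlanarSkeletonConc` (node of record), `PlanarSkeletonNeg`/`PlanarSkeletonSign` (D″) and the
planar part of the rank-`m` skeletons; the Φ-free data `Skel.KitGeom`, the seed `SkelI.kitSeed` with its case analysis, `Skel.winGraph` and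
the packing selector `KNLevels.apartSel` are IMPORTED, not re-declared.  See `SkelSeedKit`'s module docstring for the H₃ witness that makes
the generic seed a REGION and not a plaquette (reshape ruling 2026-08-20 18:39:38Z (A)).
* §1 `Skelφ.inNbr` (instance-free choice of the inner neighbour), `inNbr_spec`, `inNbr_mem_Win`;
* §2 `Skelφ.KitOK`, `Skelφ.kitSData`, `kitSData_K/seed/face`, `kitSData_pick_subset/spec`;
* §3 `mem_graphBall_of_mem_K`, `seed_subset_graphBall`, `disjoint_seed_of_not_mem_ballFin`, **`shyp_kit`**.
[cite: KozmaNitzan2024, §4 Lemma 10, p. 19 (Step III, seeds; "the seeds are independent"), p. 21 (U(P)) — the ℤ^d model]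
[cite: GrimmettPercolation1999, §7.2]
-/

noncomputable section

open scoped Classical

namespace Summit.CriticalPhenomena.PercolationContinuityZ3.Theorems.Transplant

namespace Skelφ

open Literature.Probability.Percolation Literature.Probability.LatticeModels SimpleGraph KNLevels
open Literature.Barriers.CriticalPhenomena (graphBall graphBall_finite mem_graphBall_self graphBall_mono)
open BoxProdZ2 (mem_ballFin card_ballFin_le)
open Skel (winGraph winGraph_adj KitGeom)
open SkelI (kitSeed contactEdge_mem_kitSeed edgesIn_subset_kitSeed rung_mem_kitSeed mem_kitSeed_cases exists_mem_of_mem_kitSeed)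

variable {V : Type} (G : SimpleGraph V) (φ : V → Site 2)

/-! ## §1 The inner neighbour of an outer-boundary vertex of a window (an instance-free choice) -/

/-- **The inner neighbour** of a contact `x` of the window `Win w₀ P R`: a `G`-neighbour of `x` in the ball `B_G(w₀, R)` with planar
coordinate in `P` (a classical choice from the structural form of the outer boundary, so the constant depends on `G`, `φ` and the data
only — no structure, no `DecidableEq` instance; `x` itself when there is none). [folklore] -/
def inNbr (w₀ : V) (R : ℕ) (P : Finset (Site 2)) (x : V) : V :=
  if h : ∃ y, G.Adj x y ∧ y ∈ graphBall G w₀ R ∧ φ y ∈ P then Classical.choose h else x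

variable [DecidableEq V] [G.LocallyFinite]

variable {G φ}

/-- Specification of the inner neighbour of an outer-boundary vertex: adjacent to `x`, in the ball, planar coordinate in `P`. [folklore] -/
theorem inNbr_spec {w₀ : V} {R : ℕ} {P : Finset (Site 2)} {x : V} (hx : x ∈ outerBoundary (winGraph G w₀ R) (Win G φ w₀ P R)) :
    G.Adj x (inNbr G φ w₀ R P x) ∧ inNbr G φ w₀ R P x ∈ graphBall G w₀ R ∧ φ (inNbr G φ w₀ R P x) ∈ P := by
  have h := ((mem_outerBoundary_win_iff G φ).1 hx).2.2
  rw [inNbr, dif_pos h]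
  exact Classical.choose_spec h

/-- The inner neighbour lies in the window. [folklore] -/
theorem inNbr_mem_Win {w₀ : V} {R : ℕ} {P : Finset (Site 2)} {x : V} (hx : x ∈ outerBoundary (winGraph G w₀ R) (Win G φ w₀ P R)) :
    inNbr G φ w₀ R P x ∈ Win G φ w₀ P R :=
  (mem_Win G φ).2 (inNbr_spec hx).2

variable (G φ)

/-! ## §2 The kit hypotheses and the Step-III data of a window level -/

/-- **The hypotheses on a seed geometry at the window level `j`** (`K = ∂^{out}_{winGraph} B⟨j⟩`, `B⟨j⟩ = Skelφ.winLevel G φ w₀ R lo hi j`):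
inner neighbour adjacent to the contact and in the region; region and face in `B⟨j⟩` and in `B_G(x, rs)`; region connected from the inner
neighbour inside itself; every face vertex in the region or adjacent to it; sizes `≤ cS`, `≤ cU` (the φ-level form of `SkelI.KitOK`;
Kozma–Nitzan's Step III, §4 p. 19). [this work] -/
structure KitOK (w₀ : V) (R : ℕ) (lo hi : Site 2) (j rs cS cU : ℕ) (κ : KitGeom V) : Prop where
  adj : ∀ x ∈ outerBoundary (winGraph G w₀ R) (winLevel G φ w₀ R lo hi j), G.Adj x (κ.y x)
  y_mem : ∀ x ∈ outerBoundary (winGraph G w₀ R) (winLevel G φ w₀ R lo hi j), κ.y x ∈ κ.S x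
  S_sub : ∀ x ∈ outerBoundary (winGraph G w₀ R) (winLevel G φ w₀ R lo hi j), κ.S x ⊆ winLevel G φ w₀ R lo hi j
  U_sub : ∀ x ∈ outerBoundary (winGraph G w₀ R) (winLevel G φ w₀ R lo hi j), κ.U x ⊆ winLevel G φ w₀ R lo hi j
  S_ball : ∀ x ∈ outerBoundary (winGraph G w₀ R) (winLevel G φ w₀ R lo hi j), ∀ v ∈ κ.S x, v ∈ graphBall G x rs
  U_ball : ∀ x ∈ outerBoundary (winGraph G w₀ R) (winLevel G φ w₀ R lo hi j), ∀ u ∈ κ.U x, u ∈ graphBall G x rs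
  S_path : ∀ x ∈ outerBoundary (winGraph G w₀ R) (winLevel G φ w₀ R lo hi j), ∀ v ∈ κ.S x, PathIn G (↑(κ.S x) : Set V) (κ.y x) v
  U_adj : ∀ x ∈ outerBoundary (winGraph G w₀ R) (winLevel G φ w₀ R lo hi j), ∀ u ∈ κ.U x, u ∈ κ.S x ∨ ∃ v ∈ κ.S x, G.Adj v u
  S_card : ∀ x ∈ outerBoundary (winGraph G w₀ R) (winLevel G φ w₀ R lo hi j), (κ.S x).card ≤ cS
  U_card : ∀ x ∈ outerBoundary (winGraph G w₀ R) (winLevel G φ w₀ R lo hi j), (κ.U x).card ≤ cU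

/-- **The seed data of the window level `j`** under the degree bound `hΔ`: candidate contacts = outer boundary of `B⟨j⟩` in the window graph,
seeds `SkelI.kitSeed`, faces `κ.U`, greedy selection of `k` contacts pairwise at graph distance `> 2 rs` among `N = k (Δ+1)^{2 rs}`, seed bound
`1 + Δ cS + cS cU`. [cite: KozmaNitzan2024, §4 p. 19 (Step III)] -/
def kitSData {Δ : ℕ} (hΔ : ∀ v, G.degree v ≤ Δ) (w₀ : V) (R : ℕ) (lo hi : Site 2) (j : ℕ) (κ : KitGeom V) (rs cS cU k : ℕ) :
    SData V where
  K := outerBoundary (winGraph G w₀ R) (winLevel G φ w₀ R lo hi j)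
  seed := kitSeed G κ
  face := κ.U
  pick := apartSel (fun x => BoxProdZ2.ballFin G x (2 * rs)) (Skel.center_mem_ballFin' rs) (Skel.ballFin_symm' rs) (Skel.pow_succ_pos' Δ rs)
    (fun x => card_ballFin_le G hΔ x (2 * rs)) k
  N := k * (Δ + 1) ^ (2 * rs)
  k := k
  sB := 1 + Δ * cS + cS * cU

variable {Δ : ℕ} (hΔ : ∀ v, G.degree v ≤ Δ)

/-- The candidate contacts of `kitSData`. [folklore] -/
@[simp] theorem kitSData_K (w₀ : V) (R : ℕ) (lo hi : Site 2) (j : ℕ) (κ : KitGeom V) (rs cS cU k : ℕ) :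
    (kitSData G φ hΔ w₀ R lo hi j κ rs cS cU k).K = outerBoundary (winGraph G w₀ R) (winLevel G φ w₀ R lo hi j) := rfl

/-- The seeds of `kitSData`. [folklore] -/
@[simp] theorem kitSData_seed (w₀ : V) (R : ℕ) (lo hi : Site 2) (j : ℕ) (κ : KitGeom V) (rs cS cU k : ℕ) :
    (kitSData G φ hΔ w₀ R lo hi j κ rs cS cU k).seed = kitSeed G κ := rfl

/-- The faces of `kitSData`. [folklore] -/
@[simp] theorem kitSData_face (w₀ : V) (R : ℕ) (lo hi : Site 2) (j : ℕ) (κ : KitGeom V) (rs cS cU k : ℕ) :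
    (kitSData G φ hΔ w₀ R lo hi j κ rs cS cU k).face = κ.U := rfl

/-- `N` of `kitSData`. [folklore] -/
@[simp] theorem kitSData_N (w₀ : V) (R : ℕ) (lo hi : Site 2) (j : ℕ) (κ : KitGeom V) (rs cS cU k : ℕ) :
    (kitSData G φ hΔ w₀ R lo hi j κ rs cS cU k).N = k * (Δ + 1) ^ (2 * rs) := rfl

/-- `k` of `kitSData`. [folklore] -/
@[simp] theorem kitSData_k (w₀ : V) (R : ℕ) (lo hi : Site 2) (j : ℕ) (κ : KitGeom V) (rs cS cU k : ℕ) :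
    (kitSData G φ hΔ w₀ R lo hi j κ rs cS cU k).k = k := rfl

/-- `sB` of `kitSData`. [folklore] -/
@[simp] theorem kitSData_sB (w₀ : V) (R : ℕ) (lo hi : Site 2) (j : ℕ) (κ : KitGeom V) (rs cS cU k : ℕ) :
    (kitSData G φ hΔ w₀ R lo hi j κ rs cS cU k).sB = 1 + Δ * cS + cS * cU := rfl

/-- The selection of `kitSData` is a subset. [folklore] -/
theorem kitSData_pick_subset (w₀ : V) (R : ℕ) (lo hi : Site 2) (j : ℕ) (κ : KitGeom V) (rs cS cU k : ℕ) (c : Finset V) :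
    (kitSData G φ hΔ w₀ R lo hi j κ rs cS cU k).pick c ⊆ c :=
  apartSel_subset (fun x => BoxProdZ2.ballFin G x (2 * rs)) (Skel.center_mem_ballFin' rs) (Skel.ballFin_symm' rs) (Skel.pow_succ_pos' Δ rs)
    (fun x => card_ballFin_le G hΔ x (2 * rs)) k c

/-- The selection of `kitSData` on large sets: `k` elements, pairwise at graph distance `> 2 rs`. [folklore] -/
theorem kitSData_pick_spec (w₀ : V) (R : ℕ) (lo hi : Site 2) (j : ℕ) (κ : KitGeom V) (rs cS cU k : ℕ) {c : Finset V}
    (hc : k * (Δ + 1) ^ (2 * rs) ≤ c.card) :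
    ((kitSData G φ hΔ w₀ R lo hi j κ rs cS cU k).pick c).card = k ∧
      ∀ x ∈ (kitSData G φ hΔ w₀ R lo hi j κ rs cS cU k).pick c, ∀ x' ∈ (kitSData G φ hΔ w₀ R lo hi j κ rs cS cU k).pick c,
        x ≠ x' → x' ∉ BoxProdZ2.ballFin G x (2 * rs) :=
  have h := apartSel_spec (fun x => BoxProdZ2.ballFin G x (2 * rs)) (Skel.center_mem_ballFin' rs) (Skel.ballFin_symm' rs) (Skel.pow_succ_pos' Δ rs)
    (fun x => card_ballFin_le G hΔ x (2 * rs)) hc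
  ⟨h.2.1, h.2.2⟩

/-! ## §3 Seed geometry: ball containment, disjointness; the Step-III axioms -/

variable {G φ hΔ}
variable {w₀ : V} {R : ℕ} {lo hi : Site 2} {j rs cS cU : ℕ} {κ : KitGeom V}

/-- A candidate contact lies in the ball `B_G(w₀, R)`. [folklore] -/
theorem mem_graphBall_of_mem_K {x : V} (hx : x ∈ outerBoundary (winGraph G w₀ R) (winLevel G φ w₀ R lo hi j)) :
    x ∈ graphBall G w₀ R :=
  ((mem_outerBoundary_win_iff G φ).1 hx).1

variable (hκ : KitOK G φ w₀ R lo hi j rs cS cU κ)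
include hκ

/-- **Every seed pair lies in `B_G(x, rs)`** (Step IV reads the kit inside this ball). [cite: KozmaNitzan2024, §4 p. 21 (U(P))] -/
theorem seed_subset_graphBall {x : V} (hx : x ∈ outerBoundary (winGraph G w₀ R) (winLevel G φ w₀ R lo hi j)) {e : Sym2 V}
    (he : e ∈ kitSeed G κ x) : ∀ z ∈ e, z ∈ graphBall G x rs := by
  intro z hz
  rcases (exists_mem_of_mem_kitSeed κ he).2 z hz with rfl | rfl | h | h
  · exact mem_graphBall_self G _ rs
  · exact hκ.S_ball _ hx _ (hκ.y_mem _ hx)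
  · exact hκ.S_ball _ hx _ h
  · exact hκ.U_ball _ hx _ h

/-- Seeds of contacts at graph distance `> 2 rs` are disjoint. [cite: KozmaNitzan2024, §4 p. 19 ("the seeds are independent")] -/
theorem disjoint_seed_of_not_mem_ballFin {x x' : V} (hx : x ∈ outerBoundary (winGraph G w₀ R) (winLevel G φ w₀ R lo hi j))
    (hx' : x' ∈ outerBoundary (winGraph G w₀ R) (winLevel G φ w₀ R lo hi j)) (hfar : x' ∉ BoxProdZ2.ballFin G x (2 * rs)) :
    Disjoint (kitSeed G κ x) (kitSeed G κ x') := by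
  rw [Finset.disjoint_left]
  intro e he he'
  induction e using Sym2.ind with
  | h a b =>
    have ha := seed_subset_graphBall hκ hx he a (Sym2.mem_mk_left a b)
    have ha' := seed_subset_graphBall hκ hx' he' a (Sym2.mem_mk_left a b)
    refine hfar ((mem_ballFin G).2 ?_)
    have h := BoxProdZ2.mem_graphBall_add G ha ((BoxProdZ2.mem_graphBall_comm G).1 ha')
    rwa [two_mul]

/-- **The Step-III axioms for the abstract seed kit of a window level** (φ-level; face vertices may lie in the region):
`KNLevels.SHyp L j (kitSData …)` for every window level data `L = Skelφ.winLData G φ w₀ R lo hi o Sfin`, from the Lipschitz property of `φ`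
(level nesting) and the degree bound (packing, seed count). [cite: KozmaNitzan2024, §4 p. 19 (Step III)] -/
theorem shyp_kit (hlip : Lip G φ) (o : V) (Sfin : Finset V) (k : ℕ) :
    SHyp (winLData G φ w₀ R lo hi o Sfin) j (kitSData G φ hΔ w₀ R lo hi j κ rs cS cU k) where
  Kont_sub ω := by
    rw [kitSData_K]
    exact (winLData G φ w₀ R lo hi o Sfin).Kont_subset j ω
  edge x hx e he := by
    rw [kitSData_K] at hx
    rw [kitSData_seed] at he
    have hball : ∀ z ∈ e, z ∈ graphBall G w₀ R := by
      intro z hz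
      rcases (exists_mem_of_mem_kitSeed κ he).2 z hz with rfl | rfl | h | h
      · exact mem_graphBall_of_mem_K hx
      · exact winLevel_subset_graphBall G φ w₀ R lo hi j (hκ.S_sub _ hx (hκ.y_mem _ hx))
      · exact winLevel_subset_graphBall G φ w₀ R lo hi j (hκ.S_sub _ hx h)
      · exact winLevel_subset_graphBall G φ w₀ R lo hi j (hκ.U_sub _ hx h)
    have hG : e ∈ G.edgeSet := by
      rcases mem_kitSeed_cases κ he with rfl | h | ⟨v, -, u, -, hvu, rfl⟩
      · exact (SimpleGraph.mem_edgeSet (G := G)).2 (hκ.adj _ hx)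
      · exact ((mem_edgesIn_iff).1 h).1
      · exact (SimpleGraph.mem_edgeSet (G := G)).2 hvu
    induction e using Sym2.ind with
    | h a b =>
      rw [SimpleGraph.mem_edgeSet] at hG ⊢
      exact (winGraph_adj G).2 ⟨hG, hball a (Sym2.mem_mk_left a b), hball b (Sym2.mem_mk_right a b)⟩
  within x hx e he z hz := by
    rw [kitSData_K] at hx
    rw [kitSData_seed] at he
    rw [winLData_X]
    have hmono := winLevel_monotone G φ w₀ R lo hi (Nat.le_succ j)
    rcases (exists_mem_of_mem_kitSeed κ he).2 z hz with rfl | rfl | h | h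
    · exact winLevel_nest hlip w₀ R lo hi j hx
    · exact hmono (hκ.S_sub _ hx (hκ.y_mem _ hx))
    · exact hmono (hκ.S_sub _ hx h)
    · exact hmono (hκ.U_sub _ hx h)
  touch x hx e he := by
    rw [kitSData_K] at hx
    rw [kitSData_seed] at he
    rw [winLData_X]
    rcases mem_kitSeed_cases κ he with rfl | h | ⟨v, hv, u, -, -, rfl⟩
    · exact ⟨κ.y x, Sym2.mem_mk_right _ _, hκ.S_sub _ hx (hκ.y_mem _ hx)⟩
    · induction e using Sym2.ind with
      | h a b => exact ⟨a, Sym2.mem_mk_left a b, hκ.S_sub _ hx (((mem_edgesIn_iff).1 h).2 a (Sym2.mem_mk_left a b))⟩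
    · exact ⟨v, Sym2.mem_mk_left _ _, hκ.S_sub _ hx hv⟩
  card_le x hx := by
    rw [kitSData_K] at hx
    simp only [kitSData_seed, kitSeed]
    calc ({s(x, κ.y x)} ∪ edgesIn G (κ.S x) ∪
            ((κ.S x ×ˢ κ.U x).filter fun q => G.Adj q.1 q.2).image fun q => s(q.1, q.2)).card
        ≤ ({s(x, κ.y x)} ∪ edgesIn G (κ.S x)).card +
            (((κ.S x ×ˢ κ.U x).filter fun q => G.Adj q.1 q.2).image fun q => s(q.1, q.2)).card := Finset.card_union_le _ _
      _ ≤ (1 + Δ * cS) + cS * cU := by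
          refine Nat.add_le_add ((Finset.card_union_le _ _).trans (Nat.add_le_add (by simp) ?_)) ?_
          · have hE : (edgesIn G (κ.S x)).card ≤ Δ * (κ.S x).card :=
              calc (edgesIn G (κ.S x)).card ≤ (edgesTouching G (κ.S x)).card :=
                    Finset.card_le_card (edgesIn_subset_edgesTouching _)
                _ ≤ ∑ v ∈ κ.S x, (G.incidenceFinset v).card := Finset.card_biUnion_le
                _ ≤ ∑ _v ∈ κ.S x, Δ := Finset.sum_le_sum fun v _ => by
                    rw [SimpleGraph.card_incidenceFinset_eq_degree]; exact hΔ v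
                _ = Δ * (κ.S x).card := by rw [Finset.sum_const, smul_eq_mul, mul_comm]
            exact hE.trans (Nat.mul_le_mul_left _ (hκ.S_card _ hx))
          · calc (((κ.S x ×ˢ κ.U x).filter fun q => G.Adj q.1 q.2).image fun q => s(q.1, q.2)).card
                ≤ ((κ.S x ×ˢ κ.U x).filter fun q => G.Adj q.1 q.2).card := Finset.card_image_le
              _ ≤ (κ.S x ×ˢ κ.U x).card := Finset.card_filter_le _ _
              _ = (κ.S x).card * (κ.U x).card := Finset.card_product _ _
              _ ≤ cS * cU := Nat.mul_le_mul (hκ.S_card _ hx) (hκ.U_card _ hx)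
      _ = 1 + Δ * cS + cS * cU := rfl
  conn x hx ω hω u hu := by
    rw [kitSData_K] at hx
    rw [kitSData_seed] at hω
    rw [kitSData_face] at hu
    have h1 : (openGraph ω).Adj x (κ.y x) := by
      rw [openGraph_adj]
      exact ⟨hω (Finset.mem_coe.2 (contactEdge_mem_kitSeed κ x)), (hκ.adj _ hx).ne⟩
    have hE : ∀ e ∈ edgesIn G (κ.S x), e ∈ ω := fun e he => hω (Finset.mem_coe.2 (edgesIn_subset_kitSeed κ x he))
    have h2 : ∀ v ∈ κ.S x, (openGraph ω).Reachable (κ.y x) v := by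
      intro v hv
      obtain ⟨ha, hp⟩ := hκ.S_path _ hx v hv
      clear hv
      induction hp with
      | refl => exact SimpleGraph.Reachable.refl _
      | @tail b c hab hc ih =>
        have hb : b ∈ (↑(κ.S x) : Set V) := (show PathIn G (↑(κ.S x) : Set V) (κ.y x) b from ⟨ha, hab⟩).right_mem
        refine ih.trans (SimpleGraph.Adj.reachable ?_)
        rw [openGraph_adj]
        refine ⟨hE _ ?_, hc.1.ne⟩
        rw [mem_edgesIn_iff]
        refine ⟨(SimpleGraph.mem_edgeSet (G := G)).2 hc.1, fun w hw => ?_⟩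
        rcases Sym2.mem_iff.1 hw with rfl | rfl
        · exact Finset.mem_coe.1 hb
        · exact Finset.mem_coe.1 hc.2
    rcases hκ.U_adj _ hx u hu with huS | ⟨v, hv, hvu⟩
    · exact h1.reachable.trans (h2 u huS)
    · have h3 : (openGraph ω).Adj v u := by
        rw [openGraph_adj]
        exact ⟨hω (Finset.mem_coe.2 (rung_mem_kitSeed κ hv hu hvu)), hvu.ne⟩
      exact h1.reachable.trans ((h2 v hv).trans h3.reachable)
  pick_sub c := kitSData_pick_subset G φ hΔ w₀ R lo hi j κ rs cS cU k c
  pick_card c hcK hc := (kitSData_pick_spec G φ hΔ w₀ R lo hi j κ rs cS cU k hc).1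
  pick_disj c hcK hc := by
    rw [kitSData_K] at hcK
    refine pairwiseDisjoint_apartSel (fun x => BoxProdZ2.ballFin G x (2 * rs)) (Skel.center_mem_ballFin' rs) (Skel.ballFin_symm' rs)
      (Skel.pow_succ_pos' Δ rs) (fun x => card_ballFin_le G hΔ x (2 * rs)) hc fun x hx x' hx' hfar => ?_
    exact disjoint_seed_of_not_mem_ballFin hκ (hcK hx) (hcK hx') hfar

end Skelφ

end Summit.CriticalPhenomena.PercolationContinuityZ3.Theorems.Transplant

end
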